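import Mathlib.Analysis.SpecialFunctions.Pow.Real
import Literature.Combinatorics.SimpleGraph.WallTopologicalMinor
import Literature.Combinatorics.SimpleGraph.SubcubicMinors
import Literature.Combinatorics.SimpleGraph.TreeDecomposition
import HarnessLib

/-!
# The Excluded Grid Theorem with a polynomial bound (Chuzhoy–Tan 2021)

Topic `Literature/Combinatorics/SimpleGraph`.  NAMED FACT (D-0014) over existing declarations: the tree's grid
`grid a b` (box product of paths, `WallTopologicalMinor.lean`), the minor relation `IsMinor` (`H ≼ₘ G`,
`SubcubicMinors.lean`) and `treewidth` (`TreeDecomposition.lean`).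

Source: J. Chuzhoy, Z. Tan, *Towards tight(er) bounds for the Excluded Grid Theorem*, J. Combin. Theory Ser. B 146 (2021)
219–265 (SODA 2019; arXiv:1901.07944).  Verbatim (arXiv p. 3, Theorem 1.1): "There exist constants `c₁, c₂ > 0`, such that
for every integer `g ≥ 2`, every graph of treewidth at least `k = c₁ g⁹ log^{c₂} g` contains the `(g × g)`-grid as a minor."
The `(g × g)`-grid has `g²` vertices, i.e. it is the tree's `grid (g-1) (g-1)`.  This is exactly the hypothesis (CT) carried
inline by `Literature/Computability/MetaComplexity/TseitinDepthFregeExcludedGrid.lean` (`excludedGridForm_of_chuzhoyTanForm`)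
and by `Summits/ValiantsHypothesis/…/Theorems/…LinearWidthSqrtRungChuzhoyTan.lean`; it is recorded here once, by name.
Not proved in the tree (deep: path-of-sets systems and well-linked decompositions).

## References

* [ChuzhoyTan2021] J. Chuzhoy, Z. Tan, *Towards tight(er) bounds for the Excluded Grid Theorem*, JCTB 146 (2021), Thm 1.1.
* [GalesiEtAl2023] N. Galesi et al., APAL 174 (2023), Theorem 8 (the same statement quoted as "GIRS Thm 8").
-/

namespace Literature.Combinatorics.SimpleGraph

/-- **Chuzhoy–Tan 2021, Theorem 1.1 (Excluded Grid Theorem, polynomial bound).**  "There exist constants `c₁, c₂ > 0`,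
such that for every integer `g ≥ 2`, every graph of treewidth at least `k = c₁ g⁹ log^{c₂} g` contains the `(g × g)`-grid as
a minor."  Rendering: finite simple graphs on a `Fintype`; `tw` = the tree's `treewidth`; the `(g × g)`-grid = `grid (g-1)
(g-1)`; "contains as a minor" = `IsMinor` (`≼ₘ`); `log^{c₂}` = real power of the natural logarithm.
[cite: ChuzhoyTan2021, Theorem 1.1] -/
def ChuzhoyTan2021_excludedGrid : Prop :=
  ∃ c₁ : ℝ, 0 < c₁ ∧ ∃ c₂ : ℝ, 0 < c₂ ∧ ∀ g : ℕ, 2 ≤ g →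
    ∀ (V : Type) [Fintype V] (G : _root_.SimpleGraph V),
      c₁ * (g : ℝ) ^ 9 * Real.log g ^ c₂ ≤ treewidth G → grid (g - 1) (g - 1) ≼ₘ G

end Literature.Combinatorics.SimpleGraph
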